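import Literature.Computability.AlgebraicComplexity.MonomialCountBoxDP
import Literature.Computability.AlgebraicComplexity.DIP20PlethysmCountingFormulaProofs
import Literature.Computability.AlgebraicComplexity.OrbitClosureInheritance
import Literature.Computability.AlgebraicComplexity.LMRDetThreeIdealModule
import HarnessLib

/-!
# Landsberg–Manivel–Ressayre 2013, §3.2 (n = 3): the type `(19,7,2,2,2,2,2)` occurs with
# multiplicity SIX in `S¹²(S³ℂ⁹)` — a kernel evaluation of the plethysm coefficient

Topic `Literature/Computability/AlgebraicComplexity` (val-lit cell, DAG row LMR13-A; theorem-only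
companion of `LMRDetThreeIdealModule.lean` / `LMRDetThreeIdealModuleHolds.lean`). No new facts; the
`def`s are evaluator plumbing (an enumerator of the alternating sum over `S_N` and the kernel-side
summand).

J. M. Landsberg, L. Manivel, N. Ressayre, *Hypersurfaces with degenerate duals and the geometric
complexity theory program*, Comment. Math. Helv. 88 (2013) 469–484 = arXiv:1004.4802, §3.2
«Consequences regarding Kronecker coefficients» (journal p. 476; arXiv p0006.txt:L47–57): "when
`n = 3`, the module with highest weight `12ω₁ + 5ω₂ + 2ω₇` occurs with multiplicity six in
`S¹²(S³ℂ⁹)`, but only one copy of it is in the ideal [of `\overline{GL₉ · det₃}`]." The highest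
weight `12ω₁ + 5ω₂ + 2ω₇` of `GL₉` is the partition `λ = (19,7,2,2,2,2,2) ⊢ 36`
(`lmrPartitionThree`). This file PROVES the printed multiplicity:

* `plethysmCoeffOfPartition_lmrPartitionThree : plethysmCoeffOfPartition ℂ 7 3 lmrPartitionThree = 6`
  (seven letters suffice, `ℓ(λ) = 7`), and in the tree's `GL₉`/matrix-space currency
* `plethysmCoeff_lmrPartitionThree :
    plethysmCoeff ℂ (MatIdx 3) 3 (Weight.dualOfPartition (3 * 3) lmrPartitionThree).toMatIdx = 6`,
  with the corollary `plethysmCoeff_lmrPartitionThree_le` (`≤ 6`).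

The `≤ 6` form is exactly the hypothesis `ha` of the PneNP kernel certificates
`Summits/PneNP/GCT/Certificates/PerDetHwvCertificateTwelveNineteenSeven{,Det}.lean`
(`perThree_lmr_exact_of_le`, `detThree_lmr_exact_of_LMR`, `orbitMultiplicity_detThree_lmr_eq_five_of_LMR`,
there "an engine number of the cell, taken as a hypothesis — LMR print «multiplicity six»"); with
`LMR2013_detThree_idealHwv_holds` (tree) both hypotheses of those certificates are now theorems, so
LMR's exactness clause "only one copy of it is in the ideal" (`dim (HWV_{λ^*} ∩ I(Δ(det₃))₁₂) = 1`,
det-side multiplicity `5`, per-side multiplicity `6`) is unconditional in the kernel (the one-line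
Summits-side corollaries are left to a PneNP prover; Literature does not import Summits).

## Method (what is proved)

1. Few letters (`plethysmCoeff_extend`, `dualOfPartition_comp_symm_eq_extend`, BLMW 2011 Prop.
   6.3.2, tree `OrbitClosureInheritance.lean`): the `GL₉`-multiplicity of `λ^*` in `ℂ[Sym³ℂ⁹]`
   equals `plethysmCoeffOfPartition ℂ 7 3 λ` (`plethysmCoeff_toMatIdx_lmrPartitionThree`).
2. Dörfler–Ikenmeyer–Panova 2020 eq. (4.4) in partition form (tree
   `plethysmCoeffOfPartition_eq_sum_sign_dipMonomialCount`): `a_λ(12[3]) = Σ_{π ∈ S₇} sgn(π) ·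
   c_{λ+ρ-ρ∘π}(12,3)` (terms with a negative entry `0`).
3. `sum_sign_mul_eq_altSumL`: for ANY `f`, `Σ_{π ∈ S_N} sgn(π) f(π(0),…,π(N-1))` equals the
   structural recursion `altSumL` (expansion of `π` by the image of `0` through Mathlib's
   `Equiv.Perm.decomposeFin`: `S(v :: vs)(G) = S(vs)(G ∘ cons v) - Σ_q S(vs[q ↦ v])(G ∘ cons vs[q])`,
   signs `decomposeFin.symm_sign`), which the kernel can run (`5040` leaves here).
4. `altSumL_congr`: the recursion only evaluates `G` at lists of length `N` with entries from the
   value list; on those, the printed summand (with the NONCOMPUTABLE `dipMonomialCount`) agrees with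
   the kernel summand `lmrKernelTerm` reading the count off the packed table of
   `MonomialCountBoxDP.lean` (`BoxDP.countVecMultisetsL_eq_digitAt_tables`; box `(13,7,6,5,4,3)` for
   the coordinates `1..6`, coordinate `0` pinned by `|ν| = 36`, digits `F = 77` since `85¹² < 2⁷⁷`;
   total-degree pinning `BoxDP.countVecMultisetsL_eq_zero_of_sum_ne` for the lists of wrong sum).
5. `decide +kernel`: the alternating sum of the `486` nonzero table digits is `6` (≈ 10 s).

HONEST FRAMING: a published number (LMR 2013 §3.2) re-derived in the kernel — bookkeeping for the
`(3,3)` validation row of the GCT multiplicity tables; nothing here bears on permanent versus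
determinant at large `n`; VP ≠ VNP is NOT proved and nothing in this file is progress on it.

## References

* [LandsbergManivelRessayre2013] Comment. Math. Helv. 88 (2013), §3.2 (p. 476) = arXiv:1004.4802
  §3.2.
* [DorflerIkenmeyerPanova2020] SIAM J. Appl. Algebra Geom. 4 (2020) = arXiv:1901.04576, eq.
  (4.3)–(4.4) (arXiv p. 9).
* [BurgisserEtAl2011] P. Bürgisser, J. M. Landsberg, L. Manivel, J. Weyman, SIAM J. Comput. 40
  (2011), Prop. 6.3.2 (inheritance).

## Tree

`plethysmCoeffOfPartition_eq_sum_sign_dipMonomialCount`, `dipMonomialCount_eq_L`, `dipMonomialCountL`,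
`weakCompsL` (`DIP20PlethysmCountingFormulaProofs`, `DIP20MonomialCounts`); `rho`, `rho_apply`
(`SchurPolynomials`); `plethysmCoeff_extend`, `topEmb`, `strictMono_comp_topEmb`,
`dualOfPartition_comp_symm_eq_extend` (`OrbitClosureInheritance`); `lmrPartitionThree`,
`lmrPartitionThree_parts` (`LMRDetThreeIdealModule`); `BoxDP.tables`, `BoxDP.posL`, `BoxDP.InBox`,
`BoxDP.countVecMultisetsL_eq_digitAt_tables`, `BoxDP.countVecMultisetsL_eq_zero_of_sum_ne`,
`BoxDP.length_sum_of_mem_weakCompsL` (`MonomialCountBoxDP`); Mathlib `Equiv.Perm.decomposeFin`,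
`Equiv.Perm.decomposeFin.symm_sign`, `Equiv.Perm.decomposeFin_symm_apply_zero/succ`,
`Fin.sum_univ_succ`, `Fintype.sum_prod_type`, `Fintype.sum_equiv`.
-/

open scoped BigOperators

namespace Literature.Computability.AlgebraicComplexity

open _root_.Literature.NumberTheory.DiophantineGeometry
open _root_.Literature.RingTheory.SymmetricFunctions.SymmPoly (rho rho_apply)

namespace LMRSix

/-! ### §1 A kernel-runnable enumerator of `Σ_{π ∈ S_N} sgn(π) f(π)` -/

/-- `Σ_{q} h (a + q) vs[q]` over the positions `q` of `vs`, structurally. [folklore] -/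
def sumIdxFrom : ℕ → List ℕ → (ℕ → ℕ → ℤ) → ℤ
  | _, [], _ => 0
  | a, u :: us, h => h a u + sumIdxFrom (a + 1) us h

/-- **Alternating sum over the bijections of a value list**, by the image of position `0`
(swap decomposition): `S(v :: vs)(G) = S(vs)(G ∘ cons v) - Σ_q S(vs[q ↦ v])(G ∘ cons vs[q])`;
the first argument is fuel (the length). [folklore] -/
def altSumL : ℕ → List ℕ → (List ℕ → ℤ) → ℤ
  | 0, _, G => G []
  | _ + 1, [], G => G []
  | N + 1, v :: vs, G =>
      altSumL N vs (fun l => G (v :: l)) -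
        sumIdxFrom 0 vs (fun q u => altSumL N (vs.set q v) (fun l => G (u :: l)))

/-- `sumIdxFrom` as a `Fin`-indexed sum. [folklore] -/
private theorem sumIdxFrom_eq_sum (h : ℕ → ℕ → ℤ) : ∀ (a : ℕ) (vs : List ℕ) (n : ℕ), vs.length = n →
    sumIdxFrom a vs h = ∑ q : Fin n, h (a + q) (vs.getD q 0)
  | a, [], n, hn => by subst hn; simp [sumIdxFrom]
  | a, u :: us, 0, hn => by simp at hn
  | a, u :: us, n + 1, hn => by
    rw [sumIdxFrom, Fin.sum_univ_succ]
    simp only [Fin.val_zero, Nat.add_zero, List.getD_cons_zero, Fin.val_succ, List.getD_cons_succ]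
    rw [sumIdxFrom_eq_sum h (a + 1) us n (by simpa using hn)]
    congr 1
    refine Finset.sum_congr rfl fun q _ => ?_
    rw [Nat.add_right_comm, Nat.add_assoc]

/-- `sumIdxFrom` only reads `h` at the entries of the list. [folklore] -/
private theorem sumIdxFrom_congr {h h' : ℕ → ℕ → ℤ} : ∀ (a : ℕ) (vs : List ℕ),
    (∀ q u, u ∈ vs → h q u = h' q u) → sumIdxFrom a vs h = sumIdxFrom a vs h'
  | a, [], _ => rfl
  | a, u :: us, H => by
    rw [sumIdxFrom, sumIdxFrom, H a u (by simp), sumIdxFrom_congr (a + 1) us fun q w hw =>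
      H q w (List.mem_cons_of_mem _ hw)]

/-- **`altSumL` only evaluates `G` at lists of the right length with entries from the value list.**
[folklore] -/
private theorem altSumL_congr : ∀ (N : ℕ) (V : List ℕ) (G G' : List ℕ → ℤ), V.length = N →
    (∀ l : List ℕ, l.length = N → (∀ x ∈ l, x ∈ V) → G l = G' l) → altSumL N V G = altSumL N V G'
  | 0, V, G, G', hV, H => by
    have : V = [] := List.eq_nil_of_length_eq_zero hV
    subst this
    exact H [] rfl (by simp)
  | N + 1, [], G, G', hV, _ => by simp at hV
  | N + 1, v :: vs, G, G', hV, H => by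
    simp only [List.length_cons, Nat.add_right_cancel_iff] at hV
    rw [altSumL, altSumL]
    have h1 : altSumL N vs (fun l => G (v :: l)) = altSumL N vs (fun l => G' (v :: l)) :=
      altSumL_congr N vs _ _ hV fun l hl hmem =>
        H (v :: l) (by simp [hl]) fun x hx => by
          rcases List.mem_cons.mp hx with rfl | hx
          · simp
          · exact List.mem_cons_of_mem _ (hmem x hx)
    have h2 : sumIdxFrom 0 vs (fun q u => altSumL N (vs.set q v) (fun l => G (u :: l))) =
        sumIdxFrom 0 vs (fun q u => altSumL N (vs.set q v) (fun l => G' (u :: l))) := by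
      refine sumIdxFrom_congr 0 vs fun q u hu => ?_
      exact altSumL_congr N (vs.set q v) _ _ (by rw [List.length_set, hV]) fun l hl hmem =>
        H (u :: l) (by simp [hl]) fun x hx => by
          rcases List.mem_cons.mp hx with rfl | hx
          · exact List.mem_cons_of_mem _ hu
          · rcases List.mem_or_eq_of_mem_set (hmem x hx) with h | rfl
            · exact List.mem_cons_of_mem _ h
            · simp
    rw [h1, h2]

/-- **The enumerator computes the signed sum over `S_N`**: for a value list `V` of length `N` and
any `f`, `Σ_{π ∈ S_N} sgn(π) · f(j ↦ V[π j]) = altSumL N V (l ↦ f(j ↦ l[j]))` (entries read with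
default `0`). Induction on `N` through `Equiv.Perm.decomposeFin` (`π ↔ (π 0, e)` with
`π (i+1) = swap 0 (π 0) (e i + 1)`, `sgn π = ± sgn e`). [folklore] -/
private theorem sum_sign_mul_eq_altSumL : ∀ (N : ℕ) (V : List ℕ) (hV : V.length = N)
    (f : (Fin N → ℕ) → ℤ),
    ∑ π : Equiv.Perm (Fin N), (Equiv.Perm.sign π : ℤ) * f (fun j => V.getD (π j) 0) =
      altSumL N V (fun l => f (fun j => l.getD j 0))
  | 0, V, hV, f => by
    have : V = [] := List.eq_nil_of_length_eq_zero hV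
    subst this
    rw [Fintype.sum_unique, altSumL]
    simp only [Equiv.Perm.default_eq, Equiv.Perm.sign_one, Units.val_one, one_mul]
    rfl
  | N + 1, [], hV, f => by simp at hV
  | N + 1, v :: vs, hV, f => by
    simp only [List.length_cons, Nat.add_right_cancel_iff] at hV
    -- decompose `π = decomposeFin.symm (p, e)`
    rw [← Fintype.sum_equiv Equiv.Perm.decomposeFin.symm
      (fun x => (Equiv.Perm.sign (Equiv.Perm.decomposeFin.symm x) : ℤ) *
        f (fun j => (v :: vs).getD (Equiv.Perm.decomposeFin.symm x j) 0))
      _ (fun x => rfl)]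
    rw [Fintype.sum_prod_type, Fin.sum_univ_succ]
    -- the list of values seen by `e` after choosing `π 0 = p`
    set W : Fin (N + 1) → List ℕ := fun p =>
      List.ofFn fun i : Fin N => (v :: vs).getD (Equiv.swap 0 p i.succ) 0 with hW
    have hWlen : ∀ p, (W p).length = N := fun p => by simp [hW]
    have hWget : ∀ p (i : Fin N), (W p).getD i 0 = (v :: vs).getD (Equiv.swap 0 p i.succ) 0 := by
      intro p i
      rw [List.getD_eq_getElem?_getD, hW, List.getElem?_ofFn]
      simp [i.isLt]
    -- the summand through `W p`
    have hterm : ∀ (p : Fin (N + 1)) (e : Equiv.Perm (Fin N)),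
        (Equiv.Perm.sign (Equiv.Perm.decomposeFin.symm (p, e)) : ℤ) *
          f (fun j => (v :: vs).getD (Equiv.Perm.decomposeFin.symm (p, e) j) 0) =
        (if p = 0 then 1 else -1) * ((Equiv.Perm.sign e : ℤ) *
          (fun g : Fin N → ℕ => f (Fin.cons ((v :: vs).getD p 0) g)) (fun i => (W p).getD (e i) 0)) := by
      intro p e
      rw [Equiv.Perm.decomposeFin.symm_sign, Units.val_mul]
      have hfun : (fun j => (v :: vs).getD (Equiv.Perm.decomposeFin.symm (p, e) j) 0) =
          Fin.cons ((v :: vs).getD p 0) (fun i => (W p).getD (e i) 0) := by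
        funext j
        refine Fin.cases ?_ (fun i => ?_) j
        · rw [Equiv.Perm.decomposeFin_symm_apply_zero, Fin.cons_zero]
        · rw [Equiv.Perm.decomposeFin_symm_apply_succ, Fin.cons_succ, hWget]
      rw [hfun]
      split_ifs <;> push_cast <;> ring
    simp_rw [hterm]
    -- inner sums by induction
    have hinner : ∀ p : Fin (N + 1),
        ∑ e : Equiv.Perm (Fin N), (Equiv.Perm.sign e : ℤ) *
            (fun g : Fin N → ℕ => f (Fin.cons ((v :: vs).getD p 0) g)) (fun i => (W p).getD (e i) 0) =
          altSumL N (W p) (fun l => f (fun j => ((v :: vs).getD p 0 :: l).getD j 0)) := by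
      intro p
      refine (sum_sign_mul_eq_altSumL N (W p) (hWlen p)
        (fun g => f (Fin.cons ((v :: vs).getD p 0) g))).trans ?_
      congr 1
      funext l
      show f (Fin.cons ((v :: vs).getD p 0) (fun i : Fin N => l.getD i 0)) = f (fun j => ((v :: vs).getD p 0 :: l).getD j 0)
      congr 1
      funext j
      refine Fin.cases ?_ (fun i => ?_) j
      · simp
      · simp
    simp_rw [← Finset.mul_sum, hinner]
    -- `W 0 = vs`, `W (q+1) = vs[q ↦ v]`
    have hW0 : W 0 = vs := by
      apply List.ext_getElem (by rw [hWlen, hV])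
      intro i h1 h2
      have := hWget 0 ⟨i, by rw [← hWlen 0]; exact h1⟩
      rw [List.getD_eq_getElem _ _ h1, Equiv.swap_self, Equiv.refl_apply, Fin.val_succ,
        List.getD_cons_succ, List.getD_eq_getElem _ _ h2] at this
      exact this
    have hWs : ∀ q : Fin N, W q.succ = vs.set q v := by
      intro q
      apply List.ext_getElem (by rw [hWlen, List.length_set, hV])
      intro i h1 h2
      have hi : i < N := by rw [← hWlen q.succ]; exact h1
      have := hWget q.succ ⟨i, hi⟩
      rw [List.getD_eq_getElem _ _ h1] at this
      rw [this, List.getElem_set]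
      by_cases hqi : (q : ℕ) = i
      · rw [if_pos hqi]
        have : (⟨i, hi⟩ : Fin N).succ = q.succ := by ext; simp [hqi]
        rw [this, Equiv.swap_apply_right]
        simp
      · rw [if_neg hqi]
        have hne1 : (⟨i, hi⟩ : Fin N).succ ≠ (0 : Fin (N + 1)) := Fin.succ_ne_zero _
        have hne2 : (⟨i, hi⟩ : Fin N).succ ≠ q.succ := by
          intro h; apply hqi; have := congrArg Fin.val h; simp at this; omega
        rw [Equiv.swap_apply_of_ne_of_ne hne1 hne2, Fin.val_succ, List.getD_cons_succ,
          List.getD_eq_getElem _ _ (by rw [hV]; exact hi)]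
    rw [altSumL, hW0]
    simp only [if_true, one_mul, Fin.succ_ne_zero, if_false, neg_one_mul,
      Finset.sum_neg_distrib, hWs, Fin.val_succ, List.getD_cons_succ, List.getD_cons_zero, Fin.val_zero,
      sumIdxFrom_eq_sum _ 0 vs N hV, Nat.zero_add, sub_eq_add_neg]

/-- The value list `[0, …, N-1]` turns `V[π j]` into `π j`. [folklore] -/
private theorem sum_sign_mul_eq_altSumL_range (N : ℕ) (f : (Fin N → ℕ) → ℤ) :
    ∑ π : Equiv.Perm (Fin N), (Equiv.Perm.sign π : ℤ) * f (fun j => (π j : ℕ)) =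
      altSumL N (List.range N) (fun l => f (fun j => l.getD j 0)) := by
  rw [← sum_sign_mul_eq_altSumL N (List.range N) (List.length_range) f]
  refine Finset.sum_congr rfl fun π _ => ?_
  congr 2
  funext j
  rw [List.getD_eq_getElem _ _ (by simp), List.getElem_range]

/-! ### §2 The kernel-side summand for `λ = (19,7,2,2,2,2,2)`, `d = 12`, `n = 3`, seven letters -/

/-- The rows of `λ` as a list. [cite: LandsbergManivelRessayre2013, §3.2 (p. 476)] -/
def lamL : List ℕ := [19, 7, 2, 2, 2, 2, 2]

/-- The box of the coordinates `1..6` of the count vectors `ν = λ + π - id`: `ν_k ≤ λ_k + 6 - k`.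
[folklore] -/
def boxD : List ℕ := [13, 7, 6, 5, 4, 3]

/-- The packed table of the counts `c_ν(12,3)` in seven letters, layer `12` (digits `F = 77`).
[cite: DorflerIkenmeyerPanova2020, eq. (4.3) (arXiv p. 9)] -/
def lmrTable : ℕ := (BoxDP.tables 77 boxD 7 3 12).getD 12 0

/-- The count vector `ν_j = λ_j + ρ_j - ρ_{l_j}` (`ρ_j = 6 - j`) of a value list `l`. [cite: DorflerIkenmeyerPanova2020, eq. (4.4) (arXiv p. 9)] -/
def nuOf (l : List ℕ) : List ℕ :=
  List.ofFn fun j : Fin 7 => lamL.getD j 0 + (7 - ((j : ℕ) + 1)) - (7 - (l.getD j 0 + 1))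

/-- **The kernel summand**: the guard of (4.4), the total-degree check `|ν| = 36`, and the table
digit at the cell `(ν_1, …, ν_6)`. [cite: DorflerIkenmeyerPanova2020, eq. (4.4) (arXiv p. 9)] -/
def lmrKernelTerm (l : List ℕ) : ℤ :=
  if (∀ j : Fin 7, 7 - (l.getD j 0 + 1) ≤ lamL.getD j 0 + (7 - ((j : ℕ) + 1))) ∧ (nuOf l).sum = 36
  then (digitAt 77 lmrTable (BoxDP.posL boxD (nuOf l).tail) : ℤ) else 0

/-- **THE KERNEL EVALUATION**: the alternating sum of the table digits over `S₇` is `6`.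
[cite: LandsbergManivelRessayre2013, §3.2 (p. 476)] -/
theorem altSumL_lmrKernelTerm : altSumL 7 (List.range 7) lmrKernelTerm = 6 := by
  decide +kernel

/-- The sorted parts of `λ`. [folklore] -/
private theorem sortedParts_lmrPartitionThree : lmrPartitionThree.sortedParts = lamL := by
  change lmrPartitionThree.parts.sort (· ≥ ·) = _
  rw [lmrPartitionThree_parts, Multiset.coe_sort]
  exact List.mergeSort_eq_self _ (by decide)

/-- `λ` has seven parts. [folklore] -/
private theorem card_parts_lmrPartitionThree : lmrPartitionThree.parts.card ≤ 7 := by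
  rw [lmrPartitionThree_parts, Multiset.coe_card]
  decide

/-- The printed summand of (4.4), as a function of the value vector `g = (π j)_j`.
[cite: DorflerIkenmeyerPanova2020, eq. (4.4) (arXiv p. 9)] -/
noncomputable def printedTerm (g : Fin 7 → ℕ) : ℤ :=
  if ∀ j : Fin 7, 7 - (g j + 1) ≤ lamL.getD j 0 + (7 - ((j : ℕ) + 1))
  then (dipMonomialCount (fun j : Fin 7 => lamL.getD j 0 + (7 - ((j : ℕ) + 1)) - (7 - (g j + 1))) 12 3 : ℤ)
  else 0

/-- **The printed summand agrees with the kernel summand** on every value list (in particular on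
all permutations of `0, …, 6`): the count is the table digit when `|ν| = 36`
(`BoxDP.countVecMultisetsL_eq_digitAt_tables`, the cell `(ν_1,…,ν_6)` lies in the box
`(13,7,6,5,4,3)` because `ν_k ≤ λ_k + 6 - k`), and `0` otherwise (total-degree pinning).
[cite: DorflerIkenmeyerPanova2020, eq. (4.3)–(4.4) (arXiv p. 9)] -/
theorem printedTerm_eq_lmrKernelTerm (l : List ℕ) :
    printedTerm (fun j => l.getD j 0) = lmrKernelTerm l := by
  unfold printedTerm lmrKernelTerm
  by_cases hg : ∀ j : Fin 7, 7 - (l.getD j 0 + 1) ≤ lamL.getD j 0 + (7 - ((j : ℕ) + 1))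
  · rw [if_pos hg]
    set ν : Fin 7 → ℕ := fun j => lamL.getD j 0 + (7 - ((j : ℕ) + 1)) - (7 - (l.getD j 0 + 1)) with hν
    have hnu : nuOf l = List.ofFn ν := rfl
    have hL : ∀ α ∈ weakCompsL 7 3, α.length = 7 ∧ α.sum = 3 := BoxDP.length_sum_of_mem_weakCompsL 7 3
    -- the count in list form
    have hcount : dipMonomialCount ν 12 3 = countVecMultisetsL (weakCompsL 7 3) 12 (List.ofFn ν) := by
      rw [dipMonomialCount_eq_L]; rfl
    by_cases hs : (nuOf l).sum = 36
    · rw [if_pos ⟨hg, hs⟩, hcount]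
      -- split off coordinate `0`; the tail is a box cell
      have hsplit : List.ofFn ν = ν 0 :: List.ofFn (fun k : Fin 6 => ν k.succ) := List.ofFn_succ
      have htail : (nuOf l).tail = List.ofFn (fun k : Fin 6 => ν k.succ) := by
        rw [hnu, hsplit, List.tail_cons]
      have hbox : BoxDP.InBox boxD (List.ofFn fun k : Fin 6 => ν k.succ) := by
        simp only [List.ofFn_succ, List.ofFn_zero, boxD, BoxDP.InBox, and_true]
        simp only [hν, lamL]
        refine ⟨?_, ?_, ?_, ?_, ?_, ?_⟩ <;> simp <;> omega
      have hsum : ν 0 + (List.ofFn fun k : Fin 6 => ν k.succ).sum = 3 * 12 := by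
        have : (List.ofFn ν).sum = 36 := by rw [← hnu]; exact hs
        rw [hsplit, List.sum_cons] at this
        omega
      rw [hsplit, htail, BoxDP.countVecMultisetsL_eq_digitAt_tables (F := 77) (by norm_num) (by decide +kernel)
        (by decide) (by decide +kernel) le_rfl hbox hsum]
      rfl
    · rw [if_neg (fun h => hs h.2), hcount]
      -- wrong total degree: the count vanishes
      have hz : countVecMultisetsL (weakCompsL 7 3) 12 (List.ofFn ν) = 0 := by
        apply BoxDP.countVecMultisetsL_eq_zero_of_sum_ne (weakCompsL 7 3) 3 (fun α hα => (hL α hα).2)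
        · intro α hα; rw [(hL α hα).1, List.length_ofFn]
        · rw [← hnu]; exact fun h => hs (by simpa using h)
      rw [hz]
      rfl
  · rw [if_neg hg, if_neg (fun h => hg h.1)]

/-! ### §3 The plethysm coefficient -/

/-- **LMR 2013 §3.2, `n = 3` — the multiplicity SIX, seven letters**:
`a_{(19,7,2,2,2,2,2)}(S¹²(S³ W)) = 6` (`dim W = 7`). [cite: LandsbergManivelRessayre2013, §3.2 (p. 476)] -/
theorem plethysmCoeffOfPartition_lmrPartitionThree :
    plethysmCoeffOfPartition ℂ 7 3 lmrPartitionThree = 6 := by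
  suffices h : (plethysmCoeffOfPartition ℂ 7 3 lmrPartitionThree : ℤ) = 6 by exact_mod_cast h
  rw [plethysmCoeffOfPartition_eq_sum_sign_dipMonomialCount (N := 7) (d := 12) (n := 3) (by norm_num)
    lmrPartitionThree card_parts_lmrPartitionThree]
  simp only [sortedParts_lmrPartitionThree, rho_apply]
  have h := sum_sign_mul_eq_altSumL_range 7 printedTerm
  simp only [printedTerm] at h
  rw [h, ← altSumL_lmrKernelTerm]
  refine altSumL_congr 7 (List.range 7) _ _ (List.length_range) fun l _ _ => ?_
  have := printedTerm_eq_lmrKernelTerm l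
  simp only [printedTerm] at this
  exact this

/-- The `GL₉`/matrix-space multiplicity is the seven-letter one (inheritance, BLMW Prop. 6.3.2).
[cite: BurgisserEtAl2011, Prop. 6.3.2] -/
theorem plethysmCoeff_toMatIdx_lmrPartitionThree :
    plethysmCoeff ℂ (MatIdx 3) 3 (Weight.dualOfPartition (3 * 3) lmrPartitionThree).toMatIdx =
      plethysmCoeffOfPartition ℂ 7 3 lmrPartitionThree := by
  have hKN : 7 ≤ 3 * 3 := by norm_num
  haveI : Infinite ℂ := CharZero.infinite ℂ
  obtain ⟨hsm, hup⟩ := strictMono_comp_topEmb (matIdxEquiv 3) hKN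
  have hw : (Weight.dualOfPartition (3 * 3) lmrPartitionThree).toMatIdx =
      Function.extend (fun i => matIdxEquiv 3 (topEmb hKN i)) (Weight.dualOfPartition 7 lmrPartitionThree) 0 :=
    dualOfPartition_comp_symm_eq_extend (matIdxEquiv 3) hKN lmrPartitionThree card_parts_lmrPartitionThree
  rw [hw, plethysmCoeff_extend hsm hup]
  rfl

end LMRSix

open LMRSix

/-- **Landsberg–Manivel–Ressayre 2013, §3.2 (p. 476), `n = 3`**: "the module with highest weight
`12ω₁ + 5ω₂ + 2ω₇` occurs with multiplicity six in `S¹²(S³ℂ⁹)`" — in the tree's currency, the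
plethysm coefficient of the type `λ^* `, `λ = (19,7,2,2,2,2,2) ⊢ 36` (`lmrPartitionThree`), in
`ℂ[Sym³ ℂ^{3×3}]` is `6`. [cite: LandsbergManivelRessayre2013, §3.2 (p. 476)] -/
theorem plethysmCoeff_lmrPartitionThree :
    plethysmCoeff ℂ (MatIdx 3) 3 (Weight.dualOfPartition (3 * 3) lmrPartitionThree).toMatIdx = 6 := by
  rw [plethysmCoeff_toMatIdx_lmrPartitionThree, plethysmCoeffOfPartition_lmrPartitionThree]

/-- The `≤ 6` form: exactly the hypothesis `ha` of the PneNP certificates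
`PerDetHwvCertificateTwelveNineteenSeven{,Det}.lean` (`perThree_lmr_exact_of_le`,
`detThree_lmr_exact_of_LMR`, `orbitMultiplicity_detThree_lmr_eq_five_of_LMR`), there taken as an
engine-number hypothesis. [cite: LandsbergManivelRessayre2013, §3.2 (p. 476)] -/
theorem plethysmCoeff_lmrPartitionThree_le :
    plethysmCoeff ℂ (MatIdx 3) 3 (Weight.dualOfPartition (3 * 3) lmrPartitionThree).toMatIdx ≤ 6 :=
  plethysmCoeff_lmrPartitionThree.le

/-! ### §4 The generic bridge: any plethysm coefficient as ONE kernel evaluation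

For a partition `λ` with at most `N = |D| + 1` parts the three steps above are packaged once and for
all: `plethysmCoeffOfPartition_cast_eq_altSumL_kernelTerm` rewrites `a_λ(d[n])` (in `N` letters) into
the structural alternating sum `altSumL N [0,…,N-1] (kernelTerm F D n d λ)` of packed-table digits,
which `decide +kernel` evaluates; the side conditions (box `D` large enough for the coordinates
`1, …, N-1` of the count vectors, digit size `F`, volume) are themselves decidable on literals. With the
few-letter transport `plethysmCoeff_toMatIdx_eq_plethysmCoeffOfPartition` (BLMW Prop. 6.3.2) this prices
any `GL_{m²}`-type with `≤ N` rows in `ℂ[Sym^m ℂ^{m×m}]`. (Practical range of the kernel: `N ≤ 7`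
letters or so at `n = 3`; the `(3,4)` LMR row `(65,17,2⁷) ⊢ 96` — nine letters, `495` compositions,
`F ≈ 215` — is out of reach of this layout.) -/

namespace PlethysmKernel

/-- The count vector `ν_j = λ_j + ρ_j - ρ_{l_j}` (`ρ_j = N - 1 - j`) of a value list `l`, `N` letters.
[cite: DorflerIkenmeyerPanova2020, eq. (4.4) (arXiv p. 9)] -/
def nuOfL (N : ℕ) (lamL l : List ℕ) : List ℕ :=
  List.ofFn fun j : Fin N => lamL.getD j 0 + (N - ((j : ℕ) + 1)) - (N - (l.getD j 0 + 1))

/-- **The generic kernel summand** of (4.4) for the rows `lamL` in `N = |D| + 1` letters: the guard,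
the total-degree check `|ν| = n d`, and the digit of layer `d` of `BoxDP.tables F D N n d` at the cell
`(ν_1, …, ν_{N-1})`. [cite: DorflerIkenmeyerPanova2020, eq. (4.4) (arXiv p. 9)] -/
def kernelTerm (F : ℕ) (D : List ℕ) (n d : ℕ) (lamL : List ℕ) (l : List ℕ) : ℤ :=
  if (∀ j : Fin (D.length + 1), D.length + 1 - (l.getD j 0 + 1) ≤ lamL.getD j 0 + (D.length + 1 - ((j : ℕ) + 1)))
      ∧ (nuOfL (D.length + 1) lamL l).sum = n * d
  then (digitAt F ((BoxDP.tables F D (D.length + 1) n d).getD d 0)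
      (BoxDP.posL D (nuOfL (D.length + 1) lamL l).tail) : ℤ)
  else 0

/-- `InBox` for an `ofFn` list is the pointwise bound. [cite: DorflerIkenmeyerPanova2020, eq. (4.3) (arXiv p. 9)] -/
theorem inBox_ofFn : ∀ (D : List ℕ) (g : Fin D.length → ℕ),
    (∀ k : Fin D.length, g k < D[k]) → BoxDP.InBox D (List.ofFn g)
  | [], g, _ => by simp [BoxDP.InBox]
  | d :: ds, g, h => by
    rw [List.ofFn_succ]
    simp only [BoxDP.InBox]
    refine ⟨by simpa using h 0, inBox_ofFn ds (fun k => g k.succ) fun k => ?_⟩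
    simpa using h k.succ

/-- **The printed summand of (4.4) equals the kernel summand** on every value list, provided the box
`D` dominates the coordinates `1, …, |D|` of the count vectors (`λ_{k+1} + (N-1) - (k+1) < D_k`) and
the digits cannot overflow. [cite: DorflerIkenmeyerPanova2020, eq. (4.3)–(4.4) (arXiv p. 9)] -/
theorem printedTerm_eq_kernelTerm {F n d : ℕ} (D lamL : List ℕ) (hF : 0 < F)
    (hvol : 0 < BoxDP.strideL D) (hb : ((weakCompsL (D.length + 1) n).length + 1) ^ d < 2 ^ F)
    (hD : ∀ k : Fin D.length, lamL.getD ((k : ℕ) + 1) 0 + (D.length + 1 - ((k : ℕ) + 2)) < D[k])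
    (l : List ℕ) :
    (if ∀ j : Fin (D.length + 1), D.length + 1 - (l.getD j 0 + 1) ≤ lamL.getD j 0 + (D.length + 1 - ((j : ℕ) + 1))
      then (dipMonomialCount (fun j : Fin (D.length + 1) =>
        lamL.getD j 0 + (D.length + 1 - ((j : ℕ) + 1)) - (D.length + 1 - (l.getD j 0 + 1))) d n : ℤ)
      else 0) = kernelTerm F D n d lamL l := by
  unfold kernelTerm
  set N := D.length + 1 with hN
  by_cases hg : ∀ j : Fin N, N - (l.getD j 0 + 1) ≤ lamL.getD j 0 + (N - ((j : ℕ) + 1))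
  · rw [if_pos hg]
    set ν : Fin N → ℕ := fun j => lamL.getD j 0 + (N - ((j : ℕ) + 1)) - (N - (l.getD j 0 + 1)) with hν
    have hnu : nuOfL N lamL l = List.ofFn ν := rfl
    have hL : ∀ α ∈ weakCompsL N n, α.length = N ∧ α.sum = n := BoxDP.length_sum_of_mem_weakCompsL N n
    have hcount : dipMonomialCount ν d n = countVecMultisetsL (weakCompsL N n) d (List.ofFn ν) := by
      rw [dipMonomialCount_eq_L]; rfl
    by_cases hs : (nuOfL N lamL l).sum = n * d
    · rw [if_pos ⟨hg, hs⟩, hcount]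
      have hsplit : List.ofFn ν = ν 0 :: List.ofFn (fun k : Fin D.length => ν k.succ) := List.ofFn_succ
      have htail : (nuOfL N lamL l).tail = List.ofFn (fun k : Fin D.length => ν k.succ) := by
        rw [hnu, hsplit, List.tail_cons]
      have hbox : BoxDP.InBox D (List.ofFn fun k : Fin D.length => ν k.succ) := by
        refine inBox_ofFn D _ fun k => lt_of_le_of_lt ?_ (hD k)
        simp only [hν, Fin.val_succ]
        omega
      have hsum : ν 0 + (List.ofFn fun k : Fin D.length => ν k.succ).sum = n * d := by
        have : (List.ofFn ν).sum = n * d := by rw [← hnu]; exact hs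
        rw [hsplit, List.sum_cons] at this
        exact this
      rw [hsplit, htail, BoxDP.countVecMultisetsL_eq_digitAt_tables (F := F) hF hvol rfl hb le_rfl hbox hsum]
    · rw [if_neg (fun h => hs h.2), hcount]
      have hz : countVecMultisetsL (weakCompsL N n) d (List.ofFn ν) = 0 := by
        apply BoxDP.countVecMultisetsL_eq_zero_of_sum_ne (weakCompsL N n) n (fun α hα => (hL α hα).2)
        · intro α hα; rw [(hL α hα).1, List.length_ofFn]
        · rw [← hnu]; exact hs
      rw [hz]
      rfl
  · rw [if_neg hg, if_neg (fun h => hg h.1)]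

/-- **`a_λ(d[n])` as one kernel evaluation**: for `λ ⊢ d·n` with at most `N = |D| + 1` parts and
sorted rows `lamL`, `a_λ(d[n]) = altSumL N [0,…,N-1] (kernelTerm F D n d lamL)` (Dörfler–Ikenmeyer–Panova
(4.4) + the packed table of (4.3)), under the decidable side conditions on `D` and `F`. Use (with
`n`, `d` given explicitly — they are not inferable from `Nat.Partition (d * n)` — and `N` written as
`D.length + 1`, definitional for a literal `D`):
`(plethysmCoeffOfPartition_cast_eq_altSumL_kernelTerm (F := F) (n := n) (d := d) …).trans (by decide +kernel)`.
[cite: DorflerIkenmeyerPanova2020, eq. (4.4) (arXiv p. 9)] -/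
theorem plethysmCoeffOfPartition_cast_eq_altSumL_kernelTerm {F n d : ℕ} (hn : 0 < n) (D lamL : List ℕ)
    (lam : Nat.Partition (d * n)) (hlam : lam.parts.card ≤ D.length + 1) (hlamL : lam.sortedParts = lamL)
    (hF : 0 < F) (hvol : 0 < BoxDP.strideL D) (hb : ((weakCompsL (D.length + 1) n).length + 1) ^ d < 2 ^ F)
    (hD : ∀ k : Fin D.length, lamL.getD ((k : ℕ) + 1) 0 + (D.length + 1 - ((k : ℕ) + 2)) < D[k]) :
    (plethysmCoeffOfPartition ℂ (D.length + 1) n lam : ℤ) =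
      altSumL (D.length + 1) (List.range (D.length + 1)) (kernelTerm F D n d lamL) := by
  rw [plethysmCoeffOfPartition_eq_sum_sign_dipMonomialCount (N := D.length + 1) hn lam hlam]
  simp only [hlamL, rho_apply]
  have h := sum_sign_mul_eq_altSumL_range (D.length + 1) (fun g : Fin (D.length + 1) → ℕ =>
    if ∀ j : Fin (D.length + 1), D.length + 1 - (g j + 1) ≤ lamL.getD j 0 + (D.length + 1 - ((j : ℕ) + 1))
      then (dipMonomialCount (fun j : Fin (D.length + 1) =>
        lamL.getD j 0 + (D.length + 1 - ((j : ℕ) + 1)) - (D.length + 1 - (g j + 1))) d n : ℤ)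
      else 0)
  simp only at h
  rw [h]
  exact altSumL_congr (D.length + 1) (List.range (D.length + 1)) _ _ (List.length_range)
    fun l _ _ => printedTerm_eq_kernelTerm D lamL hF hvol hb hD l

/-- **Few-letter transport** (BLMW 2011 Prop. 6.3.2, tree `plethysmCoeff_extend`): for `ℓ(λ) ≤ K ≤ m²`
the `GL_{m²}`-multiplicity of the type `λ^*` in `ℂ[Sym^m ℂ^{m×m}]` is the `K`-letter plethysm
coefficient. [cite: BurgisserEtAl2011, Prop. 6.3.2] -/
theorem plethysmCoeff_toMatIdx_eq_plethysmCoeffOfPartition {m K s : ℕ} (hKN : K ≤ m * m)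
    (lam : Nat.Partition s) (hlam : lam.parts.card ≤ K) :
    plethysmCoeff ℂ (MatIdx m) m (Weight.dualOfPartition (m * m) lam).toMatIdx =
      plethysmCoeffOfPartition ℂ K m lam := by
  haveI : Infinite ℂ := CharZero.infinite ℂ
  obtain ⟨hsm, hup⟩ := strictMono_comp_topEmb (matIdxEquiv m) hKN
  have hw : (Weight.dualOfPartition (m * m) lam).toMatIdx =
      Function.extend (fun i => matIdxEquiv m (topEmb hKN i)) (Weight.dualOfPartition K lam) 0 :=
    dualOfPartition_comp_symm_eq_extend (matIdxEquiv m) hKN lam hlam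
  rw [hw, plethysmCoeff_extend hsm hup]
  rfl

/-- Usage check of the generic bridge on the LMR type (the same `6`, now in two lines).
[cite: LandsbergManivelRessayre2013, §3.2 (p. 476)] -/
example : (plethysmCoeffOfPartition ℂ 7 3 lmrPartitionThree : ℤ) = 6 :=
  (plethysmCoeffOfPartition_cast_eq_altSumL_kernelTerm (F := 77) (n := 3) (d := 12) (by norm_num) boxD lamL
    lmrPartitionThree card_parts_lmrPartitionThree sortedParts_lmrPartitionThree (by norm_num)
    (by decide +kernel) (by decide +kernel) (by decide)).trans (by decide +kernel)

end PlethysmKernel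

end Literature.Computability.AlgebraicComplexity
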